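import Summits.CriticalPhenomena.PercolationContinuityZ3.Theorems.PercNearOneGluingNoHeavyQuantFarRelayRowBlockStar
import HarnessLib

/-!
# QUANT lane R8: the sharp linear lower tail LNT♯-EN (`C = 1`, census row R1) PROVED on stars and block-stars

builds on p205010 (kernel theorem, internal audit signed; external expert review pending)

Support file (`--supports stmt-CriticalPhenomena-4575`), QUANT lane lead (gen 5); memo
`run/shared/lean/prim/quant/prim-quant-lead-g5/LEAD-NOTES-G5.md` N12.

`Quant.lntEN_sharp_of_farRelayRow` (`…QuantFarRelayRow.lean`) derives the census row R1 = LNT♯-EN with constant one,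
`P(1 ≤ N < EN/2) ≤ s · P(o ↔ A)` whenever `P(a ↮ a') ≤ s` on `A × A`, from the GLOBAL conjecture `Quant.FarRelayRow` (via Kozma–Nitzan's
Conjecture 1).  Its proof uses FAR only at the placement `(n, w, A, o)` at hand, so we restate it pointwise (`lntEN_sharp_of_farRelayRowAt`:
FAR at `(n, w, A, o)` for all layers `j` and all `t` implies LNT♯-EN at `(n, w, A, o)`) and combine it with the proved instances
`Quant.farRelayRow_star` and `Quant.farRelayRow_blockStar`: **R1 with `C = 1` holds on every star-supported weight function
(`lntEN_sharp_star`) and on every block-star (`lntEN_sharp_blockStar`)**, both cells (`o ∈ A` allowed), unconditionally.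
No new definitions; standard axioms. [cite: KozmaNitzan2024, Conj. 1 (p. 3), Conjecture 3 (p. 15)]
-/

noncomputable section

namespace Summit.CriticalPhenomena.PercolationContinuityZ3.Theorems

open MeasureTheory Set
open Literature.Probability.LatticeModels (prodBernoulli)
open Literature.Probability.Percolation
open scoped Classical

namespace Quant

/-- **Pointwise FAR ⟹ LNT♯-EN with constant one.**  If the far-relay row holds at the placement `(n, w, A, o)` — for all `j, t`:
`2j < Σ_{a∈A} P(o ↔ a)` and `P(o ↮ a) ≤ t` (`a ∈ A`) imply `P(#{a ∈ A | o ↔ a} ≤ j) ≤ t` — then for every `s` with `P(a ↮ a') ≤ s` on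
`A × A`: `P(1 ≤ N ∧ N < EN/2) ≤ s · P(o ↔ A)`.  (Proof = that of `lntEN_sharp_of_farRelayRow`, verbatim, with the global hypothesis replaced
by the pointwise one; Kozma–Nitzan Conjecture 1 enters through the tree theorem `kozmaNitzan2024_conjecture1_holds`.)
[cite: KozmaNitzan2024, Conj. 1 (p. 3), Conjecture 3 (p. 15)] -/
theorem lntEN_sharp_of_farRelayRowAt (n : ℕ) (w : Sym2 (Fin n) → unitInterval) (A : Finset (Fin n)) (o : Fin n)
    (h : ∀ (j : ℕ) (t : ℝ),
      (2 * j : ℝ) < ∑ a ∈ A, (prodBernoulli w).real (openConn o a) →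
      (∀ a ∈ A, (prodBernoulli w).real (openConn o a)ᶜ ≤ t) →
      (prodBernoulli w).real {ω : BondConfig (Fin n) | (A.filter fun a => ω ∈ openConn o a).card ≤ j} ≤ t)
    (s : ℝ)
    (hs : ∀ a ∈ A, ∀ a' ∈ A, (prodBernoulli w).real (openConn a a' : Set (BondConfig (Fin n)))ᶜ ≤ s) :
    (prodBernoulli w).real {ω : BondConfig (Fin n) | 1 ≤ (A.filter fun a => ω ∈ openConn o a).card ∧
        ((A.filter fun a => ω ∈ openConn o a).card : ℝ) <
          1 / 2 * ∑ a ∈ A, (prodBernoulli w).real (openConn o a)} ≤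
      s * (prodBernoulli w).real (⋃ a ∈ A, openConn o a) := by
  set μ := prodBernoulli w with hμ
  have hmeas : ∀ S : Set (BondConfig (Fin n)), MeasurableSet S := fun S => (Set.toFinite S).measurableSet
  set q : Fin n → ℝ := fun a => μ.real (openConn o a : Set (BondConfig (Fin n))) with hq
  set EN : ℝ := ∑ a ∈ A, q a with hEN
  set E : Set (BondConfig (Fin n)) := {ω | 1 ≤ (A.filter fun a => ω ∈ openConn o a).card ∧
      ((A.filter fun a => ω ∈ openConn o a).card : ℝ) < 1 / 2 * EN} with hE
  set U : Set (BondConfig (Fin n)) := ⋃ a ∈ A, openConn o a with hU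
  show μ.real E ≤ s * μ.real U
  rcases A.eq_empty_or_nonempty with hAe | hne
  · -- no relays: the event is empty
    have hE0 : E = ∅ := by
      rw [Set.eq_empty_iff_forall_notMem]
      intro ω hω
      obtain ⟨h1, -⟩ := hω
      rw [hAe, Finset.filter_empty, Finset.card_empty] at h1
      exact absurd h1 (by norm_num)
    have hU0 : U = ∅ := by rw [hU, hAe]; simp
    rw [hE0, hU0, measureReal_empty]; simp
  · -- `s ≥ 0` (take `a = a'`)
    obtain ⟨a₀, ha₀⟩ := hne
    have hs0 : 0 ≤ s := le_trans measureReal_nonneg (hs a₀ ha₀ a₀ ha₀)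
    by_cases hEe : E = ∅
    · rw [hEe, measureReal_empty]; exact mul_nonneg hs0 measureReal_nonneg
    -- the event is nonempty, so `EN > 2 > 0`
    obtain ⟨ω₀, hω₀⟩ := Set.nonempty_iff_ne_empty.2 hEe
    have hENpos : 0 < EN := by
      obtain ⟨h1, h2⟩ := hω₀
      have : (1 : ℝ) ≤ ((A.filter fun a => ω₀ ∈ openConn o a).card : ℝ) := by exact_mod_cast h1
      linarith
    -- the layer `j = ⌈EN/2⌉ − 1`: `2j < EN ≤ 2j + 2`
    set k : ℕ := ⌈EN / 2⌉₊ with hk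
    have hk1 : 1 ≤ k := Nat.one_le_iff_ne_zero.2 (by rw [hk]; exact (Nat.ceil_pos.2 (by linarith)).ne')
    set j : ℕ := k - 1 with hj
    have hjk : j + 1 = k := by omega
    have hjlt : (j : ℝ) < EN / 2 := by
      have : j < k := by omega
      rw [hk] at this
      exact Nat.lt_ceil.1 this
    have hle : EN / 2 ≤ (j : ℝ) + 1 := by
      have h' : EN / 2 ≤ (k : ℝ) := Nat.le_ceil _
      have : (k : ℝ) = (j : ℝ) + 1 := by rw [← hjk]; push_cast; ring
      linarith
    -- the least likely relay `y`
    obtain ⟨y, hyA, hy⟩ := A.exists_min_image q ⟨a₀, ha₀⟩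
    -- FAR at layer `j` with `t = P(o ↮ y)`
    set S : Set (BondConfig (Fin n)) := {ω | (A.filter fun a => ω ∈ openConn o a).card ≤ j} with hS
    have hcompl : ∀ a, μ.real (openConn o a : Set (BondConfig (Fin n)))ᶜ = 1 - q a := fun a =>
      probReal_compl_eq_one_sub (hmeas _)
    have hFAR : μ.real S ≤ 1 - q y := by
      have := h j (1 - q y) (by linarith) fun a ha => by
        rw [hcompl a]; linarith [hy a ha]
      exact this
    -- Kozma–Nitzan Conjecture 1 at the least likely relay: `P(o ↔ A)(1 − s) ≤ P(o ↔ y)`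
    have hKN : μ.real U * (1 - s) ≤ q y := by
      have := kozmaNitzan2024_conjecture1_holds n w A o y (1 - s) fun a ha => by
        have h1 := hs a ha y hyA
        have h2 : (prodBernoulli w).real (openConn a y : Set (BondConfig (Fin n)))ᶜ =
            1 - (prodBernoulli w).real (openConn a y : Set (BondConfig (Fin n))) := probReal_compl_eq_one_sub (hmeas _)
        linarith
      rw [← hμ] at this
      exact this
    -- `E` and `{N = 0} = Uᶜ` are disjoint subsets of `S`
    have hEsub : E ⊆ S := by
      intro ω hω
      obtain ⟨-, h2⟩ := hω
      have : ((A.filter fun a => ω ∈ openConn o a).card : ℝ) < (j : ℝ) + 1 := by linarith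
      have : (A.filter fun a => ω ∈ openConn o a).card < j + 1 := by exact_mod_cast this
      show (A.filter fun a => ω ∈ openConn o a).card ≤ j
      omega
    have hZsub : Uᶜ ⊆ S := by
      intro ω hω
      have h0 : (A.filter fun a => ω ∈ openConn o a).card = 0 := by
        rw [Finset.card_eq_zero, Finset.filter_eq_empty_iff]
        intro a ha hωa
        exact hω (Set.mem_biUnion (Finset.mem_coe.2 ha) hωa)
      show (A.filter fun a => ω ∈ openConn o a).card ≤ j
      omega
    have hdisj : Disjoint E Uᶜ := by
      rw [Set.disjoint_left]
      intro ω hω hωU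
      obtain ⟨h1, -⟩ := hω
      obtain ⟨a, ha⟩ := Finset.card_pos.1 h1
      rw [Finset.mem_filter] at ha
      exact hωU (Set.mem_biUnion (Finset.mem_coe.2 ha.1) ha.2)
    have hsum : μ.real E + μ.real Uᶜ ≤ μ.real S := by
      rw [← measureReal_union hdisj (hmeas _)]
      exact measureReal_mono (Set.union_subset hEsub hZsub) (measure_ne_top _ _)
    have hUc : μ.real Uᶜ = 1 - μ.real U := probReal_compl_eq_one_sub (hmeas _)
    -- assemble: `μ(E) ≤ μ(S) − μ(Uᶜ) ≤ (1 − q y) − (1 − μ U) = μ U − q y ≤ s μ U`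
    nlinarith [hsum, hUc, hFAR, hKN]

/-- **R1 (LNT♯-EN, `C = 1`) on stars.**  For a weight function supported on the pairs containing the observer `o`, every `A` and `s` with
`P(a ↮ a') ≤ s` on `A × A`: `P(1 ≤ N ∧ N < EN/2) ≤ s · P(o ↔ A)`. [this work] -/
theorem lntEN_sharp_star (n : ℕ) (w : Sym2 (Fin n) → unitInterval) (A : Finset (Fin n)) (o : Fin n)
    (hstar : ∀ e : Sym2 (Fin n), o ∉ e → w e = 0) (s : ℝ)
    (hs : ∀ a ∈ A, ∀ a' ∈ A, (prodBernoulli w).real (openConn a a' : Set (BondConfig (Fin n)))ᶜ ≤ s) :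
    (prodBernoulli w).real {ω : BondConfig (Fin n) | 1 ≤ (A.filter fun a => ω ∈ openConn o a).card ∧
        ((A.filter fun a => ω ∈ openConn o a).card : ℝ) <
          1 / 2 * ∑ a ∈ A, (prodBernoulli w).real (openConn o a)} ≤
      s * (prodBernoulli w).real (⋃ a ∈ A, openConn o a) :=
  lntEN_sharp_of_farRelayRowAt n w A o (fun j t hEN ht => farRelayRow_star n w A o j t hstar hEN ht) s hs

/-- **R1 (LNT♯-EN, `C = 1`) on block-stars.**  With the data of `farRelayRow_blockStar` (gateway map `β`, glued spokes, no pairs between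
blobs, `o` touching gateways only; other weights arbitrary), every `A` and `s` with `P(a ↮ a') ≤ s` on `A × A`:
`P(1 ≤ N ∧ N < EN/2) ≤ s · P(o ↔ A)`. [this work] -/
theorem lntEN_sharp_blockStar (n : ℕ) (w : Sym2 (Fin n) → unitInterval) (A : Finset (Fin n)) (o : Fin n)
    (β : Fin n → Fin n) (hβo : ∀ x, x ≠ o → β x ≠ o)
    (hglue : ∀ x, x ≠ o → β x ≠ x → w s(β x, x) = 1)
    (hcross : ∀ x y, x ≠ o → y ≠ o → x ≠ y → β x ≠ β y → w s(x, y) = 0)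
    (hgate : ∀ x, x ≠ o → β x ≠ x → w s(o, x) = 0) (s : ℝ)
    (hs : ∀ a ∈ A, ∀ a' ∈ A, (prodBernoulli w).real (openConn a a' : Set (BondConfig (Fin n)))ᶜ ≤ s) :
    (prodBernoulli w).real {ω : BondConfig (Fin n) | 1 ≤ (A.filter fun a => ω ∈ openConn o a).card ∧
        ((A.filter fun a => ω ∈ openConn o a).card : ℝ) <
          1 / 2 * ∑ a ∈ A, (prodBernoulli w).real (openConn o a)} ≤
      s * (prodBernoulli w).real (⋃ a ∈ A, openConn o a) :=
  lntEN_sharp_of_farRelayRowAt n w A o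
    (fun j t hEN ht => farRelayRow_blockStar n w A o j t β hβo hglue hcross hgate hEN ht) s hs

end Quant

end Summit.CriticalPhenomena.PercolationContinuityZ3.Theorems
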